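import Summits.Schanuel.Schanuel.Theorems.RootDecomp1ERadixCell04
import Summits.Schanuel.Schanuel.Theorems.RootDecomp1BRadicalDescent03

/-!
# RootDecomp1ERadixCell — lens 2, generation 42 «THE FINITE-ORDER RADIX-2 CELL: count CONJUGATES, not degree» (lanes E-R19 (i) T below hyper + (iii) the transcendental weight log 2): S ITSELF on the pure-radix class {z_l = (v_l·log 2)·T^{e_l}, T real of FIXED finite exponential order} HYPOTHESIS-FREE and on the mixed radix class {z_l = (u_l + v_l log 2)·T^{e_l}} mod the ONE tree fact hX = ExplicitRatExpApprox — the Kummer-direction degree is paid by COUNTING the 𝔐 conjugates of 2^{1/𝔐} through the resultant norm Res_Y(Y^𝔐 − 2, F), never by a pair measure — continuation (RootDecomp1ERadixCell05): §5 THE PURE-RADIX ENGINE (hypothesis-free) + §5b mixed-engine helpers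

(lens-2 g42 HOME kernel RadixCell.lean d9530aae…, 1851 l, imports tree RootDecomp1EUntwistedWall04 + RootDecomp1KFiniteOrderCell02 only; CLAIM L2067, ACK + CHECKLIST E-g42 L2069, NODE L2089 / REQUEST L2090, critic VERDICT L2095 (crit g8: CLEARED — ONE CELL, tiers 1+2 = one cell; lens-2 tally CELL ×4 (g37, g39, g41, g42); E-R20 closes the radix line; PORT GO `--supports stmt-Schanuel-31410`); port by census-1 gen 18 as `RootDecomp1ERadixCell01`–`08` along K's sections: 01 = §1 the radix field ℚ(2^{1/𝔐}) (`croot`, `zroot`, `broot`, `irreducible_X_pow_sub_two`, degree 𝔐); 02 = §2 the two-level polynomial, conjugate factors `Gfac`, the RESULTANT NORM `resNorm` (`map_resNorm` = ∏ conjugates, `resNorm_ne_zero`, degree / value / Mahler-measure bounds); 03 = §3 the radix curve point `radixPt`, germs, fibres, root and residue avoidance at transcendental parameters; 04 = §4 integral exponents at the collapse (`Mden`, `Aexp`, `Bexp`, the value of G₀, from avoidance to the hypotheses of `resNorm_ne_zero`); 05 = §5 THE PURE-RADIX ENGINE `algebraicIndependent_radixPt_pure` (hypothesis-free, `endgame_pure`)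 + §5b mixed-engine helpers; 06 = §5b THE MIXED ENGINE `algebraicIndependent_radixPt (hX)` (one 320-line theorem, scoped `maxHeartbeats 800000` carried as in K); 07 = §6 classes `InPureRadixClass` / `InRadixClass`, `schanuel_inPureRadixClass` (hyp-free) / `schanuel_inRadixClass (hX)`, cells `cell_31410(_pure)` / `cell_25020(_pure)`, members `zLog2Curve` / `zMix` at tower numbers; 08 = §6 items AT the members + separation (`zMix_not_inPointClass`, `zLog2Curve_not_inPointClass`, `zMix_separation`).
PORT EDITS: 37 one-line docstrings added; five generic helpers made `private` against dedup twins (`mahlerMeasure_finset_prod`, `eval_map_intCast`, `aeval_ne_zero_of_transcendental`, `addNat_eq_natAdd`, `transcendental_log_two` ≡ tree AclSubsetLogFreeCore/Negative) with per-part private copies; statements and proofs verbatim; after the dedup bounce of 05 (p828625: `exists_int_relation` ≡ tree `RootDecomp1BRadicalDescent.exists_int_relation`, RadicalDescent03) K's copy was DELETED and the tree declaration is reused via `import …RootDecomp1BRadicalDescent03` + `open … (exists_int_relation)` in 05/06. `--supports stmt-Schanuel-31410`; no census credit carried; rung 0 — nothing here proves Schanuel.)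
-/

noncomputable section

open Complex Polynomial IntermediateField Filter
open scoped BigOperators Topology

namespace Summit.Schanuel.Schanuel.Theorems.RootDecomp1ERadixCell

open Summit.Schanuel.Schanuel.Theorems.RootDecomp1EUntwistedWall (gι gaussPt expo coef tail fib IsZ wden wden_pos
  isZ_expo Wb Wb_nonneg abs_expo_le abs_coef_le expo_eq_of_tail_eq sum_coef_fibre_cast fib_ne_zero diffPoly
  diffPoly_ne_zero eval_diffPoly gι_expo_sub gι_injective tail_eq_of_expo_eq eq_of_tail_eq_of_zero_eq coef_cast
  IsZ.add IsZ.mul IsZ.natCast IsZ.sum isZ_wden_fst isZ_wden_snd InGaussCurveClass)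
open Summit.Schanuel.Schanuel.Theorems.RootDecomp1EPointTransfer (InPointClass)
open Summit.Schanuel.Schanuel.Theorems.RootDecomp1ETwoScale (InTwoScaleClass)
open Summit.Schanuel.Schanuel.Theorems.RootDecomp1EWallDichotomy (InTwistedFrameClass)
open Summit.Schanuel.Schanuel.Theorems.RootDecomp1KHyper
open Summit.Schanuel.Schanuel.Theorems.RootDecomp1KHyper.HyperCell
open Summit.Schanuel.Schanuel.Theorems.RootDecomp1KGeneric (LiouvilleOrder)
open Summit.Schanuel.Schanuel.Theorems.RootDecomp1KFiniteOrderCell (towerNumber liouvilleOrder_towerNumber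
  not_hyperLiouville_towerNumber towerNumber_pos not_liouvilleOrder_towerNumber)
open Summit.Schanuel.Schanuel.Theorems.RootDecomp1BDefectFloorCells (natCast_le_trdeg_of_algebraicIndependent)

open Summit.Schanuel.Schanuel.Theorems.RootDecomp1BRadicalDescent (exists_int_relation)

/-! ## §5  THE PURE-RADIX ENGINE — hypothesis-free: `T, 2^{v₁T^{e₁}}, …, 2^{v_nT^{e_n}}` are algebraically
independent for `T` real of FINITE exponential order `Σe + 3` -/

section Engine

variable {n : ℕ}

/-- Each exponent of a support monomial is at most the total degree (tree one-liner, private copy). -/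
private theorem apply_le_totalDegree' {P : MvPolynomial (Fin (n + 1)) ℤ} {s : Fin (n + 1) →₀ ℕ}
    (hs : s ∈ P.support) (i : Fin (n + 1)) : s i ≤ P.totalDegree := by
  refine le_trans ?_ (MvPolynomial.le_totalDegree hs)
  by_cases hi : i ∈ s.support
  · exact Finset.single_le_sum (f := fun j => s j) (fun _ _ => Nat.zero_le _) hi
  · simp [Finsupp.notMem_support_iff.mp hi]

/-- **ENDGAME ARITHMETIC OF THE PURE TIER**: `1 ≤ M (q^D c_G)^𝔐 η`, `𝔐 ≤ wd·q^K`, `η < e^{−q^m}`, `m ≥ K+2`,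
`q ≥ M + wd(D + c_G)` is contradictory. -/
theorem endgame_pure {q m K D Mn : ℕ} {M cG wd η : ℝ} (hq : 2 ≤ q) (hM : 0 < M) (hcG : 1 ≤ cG)
    (hwd : 1 ≤ wd) (hMn : (Mn : ℝ) ≤ wd * (q : ℝ) ^ K) (hm : K + 2 ≤ m) (hC : M + wd * (D + cG) ≤ q)
    (hη : η < Real.exp (-((q : ℝ) ^ m))) (h1 : 1 ≤ M * ((q : ℝ) ^ D * cG) ^ Mn * η) : False := by
  have hq2 : (2 : ℝ) ≤ q := by exact_mod_cast hq
  have hq1 : (1 : ℝ) ≤ q := by linarith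
  have hD0 : (0 : ℝ) ≤ D := Nat.cast_nonneg D
  have hy1 : 1 ≤ (q : ℝ) ^ D * cG := one_le_mul_of_one_le_of_one_le (one_le_pow₀ hq1) hcG
  have hypos : 0 < (q : ℝ) ^ D * cG := by positivity
  have hlogy : Real.log ((q : ℝ) ^ D * cG) ≤ (D + cG) * q := by
    rw [Real.log_mul (by positivity) (by positivity), Real.log_pow]
    have h1 : Real.log (q : ℝ) ≤ q := (Real.log_le_sub_one_of_pos (by positivity)).trans (by linarith)
    have h2 : Real.log cG ≤ cG := (Real.log_le_sub_one_of_pos (by positivity)).trans (by linarith)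
    have h3 : cG ≤ cG * q := le_mul_of_one_le_right (by linarith) hq1
    nlinarith
  have hlogy0 : 0 ≤ Real.log ((q : ℝ) ^ D * cG) := Real.log_nonneg hy1
  have hX : ((q : ℝ) ^ D * cG) ^ Mn ≤ Real.exp (wd * (q : ℝ) ^ K * ((D + cG) * q)) := by
    rw [← Real.exp_log hypos, ← Real.exp_nat_mul]
    exact Real.exp_le_exp.mpr (mul_le_mul hMn hlogy hlogy0 (by positivity))
  have hMexp : M ≤ Real.exp M := by linarith [Real.add_one_le_exp M]
  have hK1 : (1 : ℝ) ≤ (q : ℝ) ^ (K + 1) := one_le_pow₀ hq1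
  have hexp : M + wd * (q : ℝ) ^ K * ((D + cG) * q) ≤ (q : ℝ) ^ m := by
    have e1 : wd * (q : ℝ) ^ K * ((D + cG) * q) = wd * (D + cG) * (q : ℝ) ^ (K + 1) := by ring
    have e2 : M ≤ M * (q : ℝ) ^ (K + 1) := le_mul_of_one_le_right hM.le hK1
    have e3 : (M + wd * (D + cG)) * (q : ℝ) ^ (K + 1) ≤ (q : ℝ) * (q : ℝ) ^ (K + 1) :=
      mul_le_mul_of_nonneg_right hC (by positivity)
    have e4 : (q : ℝ) * (q : ℝ) ^ (K + 1) = (q : ℝ) ^ (K + 2) := by ring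
    have e5 : (q : ℝ) ^ (K + 2) ≤ (q : ℝ) ^ m := pow_le_pow_right₀ hq1 hm
    nlinarith
  have hMX : M * ((q : ℝ) ^ D * cG) ^ Mn ≤ Real.exp ((q : ℝ) ^ m) :=
    calc M * ((q : ℝ) ^ D * cG) ^ Mn ≤ Real.exp M * Real.exp (wd * (q : ℝ) ^ K * ((D + cG) * q)) :=
          mul_le_mul hMexp hX (by positivity) (by positivity)
      _ = Real.exp (M + wd * (q : ℝ) ^ K * ((D + cG) * q)) := (Real.exp_add _ _).symm
      _ ≤ Real.exp ((q : ℝ) ^ m) := Real.exp_le_exp.mpr hexp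
  have hpos : 0 < M * ((q : ℝ) ^ D * cG) ^ Mn := by positivity
  have h2 : M * ((q : ℝ) ^ D * cG) ^ Mn * η < 1 :=
    calc M * ((q : ℝ) ^ D * cG) ^ Mn * η < M * ((q : ℝ) ^ D * cG) ^ Mn * Real.exp (-((q : ℝ) ^ m)) :=
          mul_lt_mul_of_pos_left hη hpos
      _ ≤ Real.exp ((q : ℝ) ^ m) * Real.exp (-((q : ℝ) ^ m)) :=
          mul_le_mul_of_nonneg_right hMX (Real.exp_pos _).le
      _ = 1 := by rw [← Real.exp_add, add_neg_cancel, Real.exp_zero]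
  linarith

/-- Approximant bookkeeping: if `|T − r| < e^{−C}` and `|log x| ≤ C` for a positive `x`, then `|T − r| < x`. -/
theorem lt_of_abs_log_le {η C x : ℝ} (hη : η < Real.exp (-C)) (hx : 0 < x) (hlx : |Real.log x| ≤ C) : η < x := by
  refine hη.trans_le ?_
  calc Real.exp (-C) ≤ Real.exp (Real.log x) := Real.exp_le_exp.mpr (by linarith [neg_abs_le (Real.log x)])
    _ = x := Real.exp_log hx

/-- **THE PURE-RADIX ENGINE (E-g42, Tier 1) — NO registered fact, NO hypothesis beyond the data.**
For `T > 0` real of exponential order `Σ_l e_l + 3` (`LiouvilleOrder`, tree class of lens 1 — FINITE order,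
NOT hyper-Liouville), rational `v_l ≥ 0` with `v_l = 0` where `e_l = 0`, and the monomials `(i v_l) X^{e_l}`
`ℤ`-free (g41 freeness, `u ≡ 0`): `T, 2^{v₁T^{e₁}}, …, 2^{v_nT^{e_n}}` are ALGEBRAICALLY INDEPENDENT over `ℚ`.
Mechanism: collapse an integer relation at `r = p/q` (`|T − r| < e^{−q^{Σe+3}}`); the exponentials become powers
of the radix root `2^{1/𝔐}`, `𝔐 = wden·q^{Σe}`; the NORM `ℚ(2^{1/𝔐}) → ℚ` of the collapsed relation — the resultant
`Res_Y(Y^𝔐 − 2, F)` — is a NON-ZERO INTEGER (degree `[ℚ(2^{1/𝔐}):ℚ] = 𝔐` by Eisenstein + residue avoidance near the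
transcendental `T`), hence `≥ 1`, but it is the product of `𝔐` conjugates of size `≤ q^D c` one of which is
`q^D|F(r)| ≤ q^D K e^{−q^{Σe+3}}`: COUNT CONJUGATES (`𝔐 ~ q^{Σe}` factors), never degree. -/
theorem algebraicIndependent_radixPt_pure (w : Fin n → ℚ × ℚ) (e : Fin n → ℕ) {T : ℝ} (hT0 : 0 < T)
    (hT : LiouvilleOrder ((∑ l, e l) + 3) T) (hu : ∀ l, (w l).1 = 0) (hv : ∀ l, 0 ≤ (w l).2)
    (hv0 : ∀ l, e l = 0 → (w l).2 = 0)
    (hLI : LinearIndependent ℤ (fun l : Fin n => Polynomial.monomial (e l) (gι (w l)))) :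
    AlgebraicIndependent ℚ (radixPt w e (T : ℂ)) := by
  classical
  by_contra hdep
  obtain ⟨P, hP0, hPu⟩ := exists_int_relation hdep
  have hFT : FR P w e T = 0 := by rw [FR_eq_aeval]; exact hPu
  set D : ℕ := P.totalDegree with hDdef
  have hD : ∀ s ∈ P.support, ∀ i, s i ≤ D := fun s hs i => apply_le_totalDegree' hs i
  have hD0 : ∀ s ∈ P.support, s 0 ≤ D := fun s hs => hD s hs 0
  obtain ⟨t, ht⟩ : ∃ t, t ∈ P.support := by
    obtain ⟨t, ht⟩ := MvPolynomial.ne_zero_iff.mp hP0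
    exact ⟨t, MvPolynomial.mem_support_iff.mpr ht⟩
  have hu' : ∀ l, 0 ≤ (w l).1 := fun l => (hu l).symm.le
  have hTt : Transcendental ℚ T := transcendental_of_liouvilleOrder (by omega) hT
  -- ROOT AND RESIDUE AVOIDANCE, eventually near `T`
  set pairs : Finset ((Fin n → ℕ) × (Fin n → ℕ)) :=
    ((P.support.image tail) ×ˢ (P.support.image tail)).filter (fun p => p.1 ≠ p.2) with hpairs
  have hev : ∀ᶠ x : ℝ in 𝓝 T, aeval x (fib P (tail t)) ≠ 0 ∧ ∀ p ∈ pairs,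
      (aeval x (Δ1 w e p.1 p.2) ≠ 0 ∨ aeval x (Δ2 w e p.1 p.2) ∉ Set.range (Int.cast : ℤ → ℝ)) := by
    refine (eventually_fib_ne_zero P ht hTt).and ?_
    rw [Filter.eventually_all_finset]
    intro p hp
    exact eventually_avoid hLI hv0 hTt (Finset.mem_filter.mp hp).2
  obtain ⟨δ₀, hδ₀, hball⟩ := Metric.eventually_nhds_iff.mp hev
  -- local Lipschitz bound of `F` at `T`
  obtain ⟨Kl, δ₁, hKl0, hδ₁, hlip⟩ := exists_lipschitz_FR P w e T
  set M : ℝ := Kl + 1 with hM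
  have hM0 : 0 < M := by rw [hM]; linarith
  -- constants (depend on `T, w, e, P` only)
  set K : ℕ := ∑ l, e l with hK
  set R : ℝ := T + 2 with hR
  have hR1 : 1 ≤ R := by rw [hR]; linarith
  have hR0 : 0 ≤ R := by linarith
  set Lr : ℝ := ∑ s ∈ P.support, |((MvPolynomial.coeff s P : ℤ) : ℝ)| with hLr
  have hLr0 : 0 ≤ Lr := Finset.sum_nonneg fun s _ => abs_nonneg _
  set cG : ℝ := Lr * (R ^ D * Real.exp ((D : ℝ) * Wb w e R)) + 1 with hcG
  have hcGm : 0 ≤ Lr * (R ^ D * Real.exp ((D : ℝ) * Wb w e R)) := by positivity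
  have hcG1 : 1 ≤ cG := by rw [hcG]; linarith
  set wd : ℝ := (wden w : ℝ) with hwd
  have hwd1 : 1 ≤ wd := by rw [hwd]; exact_mod_cast wden_pos w
  have hDr0 : (0 : ℝ) ≤ D := Nat.cast_nonneg D
  set C : ℝ := M + wd * (D + cG) + |Real.log δ₀| + |Real.log δ₁| + |Real.log T| with hC
  have habs0 := abs_nonneg (Real.log δ₀)
  have habs1 := abs_nonneg (Real.log δ₁)
  have habsT := abs_nonneg (Real.log T)
  have hwdc : 0 ≤ wd * (D + cG) := by positivity
  have hCmain : M + wd * (D + cG) ≤ C := by rw [hC]; linarith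
  have hC0 : 0 ≤ C := by linarith
  -- THE APPROXIMANT `r = p/q`: `q ≥ ⌈C⌉ + 2`, `|T − r| < exp(−q^{K+3})`
  obtain ⟨r, hden, hne, hlt⟩ := hT (⌈C⌉₊ + 2)
  set q : ℕ := r.den with hq
  have hq2 : 2 ≤ q := le_trans (by omega) hden
  have hq1r : (1 : ℝ) ≤ q := by exact_mod_cast (show 1 ≤ q by omega)
  have hCq : C ≤ (q : ℝ) := by
    have h1 : ((⌈C⌉₊ + 2 : ℕ) : ℝ) ≤ q := by exact_mod_cast hden
    push_cast at h1
    linarith [Nat.le_ceil C]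
  set η : ℝ := |T - r| with hη
  have hη0 : 0 < η := abs_pos.mpr (sub_ne_zero.mpr hne)
  have hηlt : η < Real.exp (-((q : ℝ) ^ (K + 3))) := hlt
  have hqm1 : (q : ℝ) ≤ (q : ℝ) ^ (K + 3) := le_self_pow₀ hq1r (by omega)
  have hηC : η < Real.exp (-C) := hηlt.trans_le (Real.exp_le_exp.mpr (by linarith))
  have hηδ₀ : η < δ₀ := lt_of_abs_log_le hηC hδ₀ (by rw [hC]; linarith)
  have hηδ₁ : η < δ₁ := lt_of_abs_log_le hηC hδ₁ (by rw [hC]; linarith)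
  have hηT : η < T := lt_of_abs_log_le hηC hT0 (by rw [hC]; linarith)
  have hη1 : η ≤ 1 := hηC.le.trans (by rw [Real.exp_le_one_iff]; linarith)
  have hr0 : 0 < r := by
    have h1 := abs_lt.mp (show |T - r| < T from hηT)
    exact_mod_cast (show (0 : ℝ) < r by linarith [h1.2])
  have hr0' : 0 ≤ r := hr0.le
  have hrR : |(r : ℝ)| ≤ R := by
    have h1 : |(r : ℝ)| ≤ |T| + |T - r| := by
      calc |(r : ℝ)| = |T - (T - r)| := by ring_nf
        _ ≤ |T| + |T - r| := abs_sub _ _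
    rw [abs_of_pos hT0] at h1
    rw [hR]; linarith
  -- avoidance AT `r`
  obtain ⟨hfibr, havr⟩ := hball (show dist (r : ℝ) T < δ₀ by rw [Real.dist_eq, abs_sub_comm]; exact hηδ₀)
  have hav : AvoidAt P w e r := by
    intro s hs s' hs' hne'
    have hp : (tail s, tail s') ∈ pairs := Finset.mem_filter.mpr
      ⟨Finset.mem_product.mpr ⟨Finset.mem_image_of_mem _ hs, Finset.mem_image_of_mem _ hs'⟩, hne'⟩
    rcases havr _ hp with h1 | h2
    · left; intro h0; apply h1; rw [aeval_ratCast, h0, Rat.cast_zero]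
    · right; rintro ⟨z, hz⟩; apply h2; exact ⟨z, by rw [aeval_ratCast, hz, Rat.cast_intCast]⟩
  -- THE RESULTANT NORM `R₀ ∈ ℤ[X]`, non-zero
  have hMn0 : 0 < Mden w e r := Mden_pos w e r
  set R₀ : ℤ[X] := resNorm (Mden w e r) P.support (coef P D r) (Aexp w e r) (Bexp w e r) with hR₀
  have hres := hres_of_avoid hu' hv hr0' hav ht
  have hsum := hsum_of_avoid P hD0 hu' hv hr0' hav ht hfibr
  have hR0ne : R₀ ≠ 0 := resNorm_ne_zero hMn0 hres hsum
  -- PURE: `R₀` is a constant (all `A' = 0`), so `1 ≤ |R₀| = ‖R₀(x)‖`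
  have hA0 : ∀ s ∈ P.support, Aexp w e r s ≤ 0 := fun s _ => (Aexp_eq_zero hu e r s).le
  have hdeg : R₀.natDegree = 0 :=
    Nat.eq_zero_of_le_zero ((natDegree_resNorm_le hMn0 (coef P D r) (Bexp w e r) hA0).trans (by simp))
  set x : ℝ := Real.exp (((Mden w e r : ℕ) : ℝ)⁻¹) with hx
  have hlow : (1 : ℝ) ≤ ‖aeval (x : ℂ) R₀‖ := by
    have ha : R₀ = Polynomial.C (R₀.coeff 0) := Polynomial.eq_C_of_natDegree_eq_zero hdeg
    have ha0 : R₀.coeff 0 ≠ 0 := fun h => hR0ne (by rw [ha, h, map_zero])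
    rw [ha, aeval_C, algebraMap_int_eq, eq_intCast, Complex.norm_intCast]
    exact_mod_cast Int.one_le_abs ha0
  -- UPPER BOUND: `‖R₀(x)‖ = ∏_i ‖G_i(x)‖ ≤ M (q^D c_G)^𝔐 η`
  set Gn : ℕ → ℝ := fun i =>
    ‖(Gfac (Mden w e r) P.support (coef P D r) (Aexp w e r) (Bexp w e r) i).eval (x : ℂ)‖ with hGn
  have hGn0 : ∀ i, 0 ≤ Gn i := fun i => norm_nonneg _
  have hGi : ∀ i, Gn i ≤ (q : ℝ) ^ D * cG := by
    intro i
    refine (norm_eval_Gfac_collapse_le P D hu' hv e hr0' i).trans ?_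
    have hl2 : Real.log 2 ≤ 1 := by
      have := Real.log_le_sub_one_of_pos (x := 2) two_pos; linarith
    have hterm : ∀ s ∈ P.support, |(coef P D r s : ℝ)| * Real.exp (ρr (expo w e r s)) ≤
        |((MvPolynomial.coeff s P : ℤ) : ℝ)| * (R ^ D * (q : ℝ) ^ D) * Real.exp ((D : ℝ) * Wb w e R) := by
      intro s hs
      refine mul_le_mul (abs_coef_le P hR1 hrR (hD0 s hs)) (Real.exp_le_exp.mpr ?_) (Real.exp_pos _).le
        (by positivity)
      have hb := abs_expo_le w e hrR (hD s hs)
      have h2nn : (0 : ℝ) ≤ ((expo w e r s).2 : ℝ) := by exact_mod_cast expo_snd_nonneg hv e hr0' s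
      have h1le : ((expo w e r s).1 : ℝ) ≤ |((expo w e r s).1 : ℝ)| := le_abs_self _
      have h2le : ((expo w e r s).2 : ℝ) * Real.log 2 ≤ |((expo w e r s).2 : ℝ)| := by
        rw [abs_of_nonneg h2nn]
        calc ((expo w e r s).2 : ℝ) * Real.log 2 ≤ ((expo w e r s).2 : ℝ) * 1 :=
              mul_le_mul_of_nonneg_left hl2 h2nn
          _ = _ := mul_one _
      rw [ρr]; linarith
    refine (Finset.sum_le_sum hterm).trans ?_
    rw [← Finset.sum_mul, ← Finset.sum_mul, ← hLr]
    have : Lr * (R ^ D * (q : ℝ) ^ D) * Real.exp ((D : ℝ) * Wb w e R) =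
        (q : ℝ) ^ D * (Lr * (R ^ D * Real.exp ((D : ℝ) * Wb w e R))) := by ring
    rw [this]
    exact mul_le_mul_of_nonneg_left (by rw [hcG]; linarith) (by positivity)
  have hG0 : Gn 0 ≤ (q : ℝ) ^ D * M * η := by
    show ‖(Gfac (Mden w e r) P.support (coef P D r) (Aexp w e r) (Bexp w e r) 0).eval (x : ℂ)‖ ≤ _
    rw [hx, eval_Gfac_zero P hD0 hu' hv e hr0', norm_mul, norm_pow, Complex.norm_natCast]
    have h1 : ‖FR P w e r‖ ≤ M * η := by
      have h2 := hlip r (by rw [abs_sub_comm]; exact hηδ₁)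
      rw [hFT, sub_zero, abs_sub_comm] at h2
      calc ‖FR P w e r‖ ≤ Kl * η := h2
        _ ≤ M * η := mul_le_mul_of_nonneg_right (by rw [hM]; linarith) hη0.le
    calc (r.den : ℝ) ^ D * ‖FR P w e r‖ ≤ (q : ℝ) ^ D * (M * η) := by rw [hq]; gcongr
      _ = (q : ℝ) ^ D * M * η := by ring
  have hup : ‖aeval (x : ℂ) R₀‖ ≤ M * ((q : ℝ) ^ D * cG) ^ (Mden w e r) * η := by
    rw [hR₀, norm_aeval_resNorm hMn0]
    change ∏ i ∈ Finset.range (Mden w e r), Gn i ≤ _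
    obtain ⟨k, hk⟩ := Nat.exists_eq_succ_of_ne_zero hMn0.ne'
    have hsplit : ∏ i ∈ Finset.range (Mden w e r), Gn i = (∏ i ∈ Finset.range k, Gn (i + 1)) * Gn 0 := by
      rw [show Finset.range (Mden w e r) = Finset.range (k + 1) by rw [hk], Finset.prod_range_succ']
    have hP : ∏ i ∈ Finset.range k, Gn (i + 1) ≤ ((q : ℝ) ^ D * cG) ^ k := by
      refine (Finset.prod_le_prod (fun i _ => hGn0 _) fun i _ => hGi (i + 1)).trans ?_
      rw [Finset.prod_const, Finset.card_range]
    have hqD : (q : ℝ) ^ D ≤ (q : ℝ) ^ D * cG := le_mul_of_one_le_right (by positivity) hcG1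
    rw [hsplit]
    calc (∏ i ∈ Finset.range k, Gn (i + 1)) * Gn 0
        ≤ ((q : ℝ) ^ D * cG) ^ k * ((q : ℝ) ^ D * M * η) := mul_le_mul hP hG0 (hGn0 0) (by positivity)
      _ ≤ ((q : ℝ) ^ D * cG) ^ k * (((q : ℝ) ^ D * cG) * M * η) := by gcongr
      _ = M * ((q : ℝ) ^ D * cG) ^ (k + 1) * η := by ring
      _ = M * ((q : ℝ) ^ D * cG) ^ (Mden w e r) * η := by rw [hk]
  -- sizes and the endgame
  have hMn : ((Mden w e r : ℕ) : ℝ) ≤ wd * (q : ℝ) ^ K := by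
    rw [Mden, hwd, hq, ← hK]; push_cast; exact le_rfl
  exact endgame_pure hq2 hM0 hcG1 hwd1 hMn (by omega : K + 2 ≤ K + 3) (hCmain.trans hCq) hηlt (hlow.trans hup)

end Engine

/-! ## §5b  THE MIXED ENGINE mod `hX = ExplicitRatExpApprox` (tree def, RootDecomp1KHyper06) — general `u_l ≥ 0`:
the resultant `R₀` is a genuine polynomial in `x = e^{1/𝔐}`; a root `ξ` of it near `x`, its irreducible factor
`Q ∣ R₀` (Gauss), `M(Q) ≤ M(R₀) ≤ (q^D c)^𝔐`, and the explicit measure `hX` at the RATIONAL exponent `1/𝔐`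
feed the lineage endgame `endgame_gen` (RootDecomp1KHyper11, BY NAME) at the FIXED order `13·Σe + 4`. -/

section MixedEngine

variable {n : ℕ}

/-- A non-zero integer polynomial has Mahler measure `≥ 1` (re-proof of the private tree lemma in RootDecomp1KHyper06). -/
private theorem one_le_mahlerMeasure_map_of_ne_zero' {R : ℤ[X]} (hR : R ≠ 0) :
    1 ≤ (R.map (Int.castRingHom ℂ)).mahlerMeasure := by
  refine one_le_mahlerMeasure_of_one_le_norm_leadingCoeff ?_
  rw [Polynomial.leadingCoeff_map_of_injective (RingHom.injective_int _), eq_intCast,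
    Complex.norm_intCast]
  exact_mod_cast Int.one_le_abs (Polynomial.leadingCoeff_ne_zero.mpr hR)

/-- `M(Q) ≤ M(A)` for `Q ∣ A ≠ 0` in `ℤ[X]` (tree-private in the lineage files; re-proved). -/
private theorem mahlerMeasure_le_of_dvd' {Q A : ℤ[X]} (hdvd : Q ∣ A) (hA : A ≠ 0) :
    (Q.map (Int.castRingHom ℂ)).mahlerMeasure ≤ (A.map (Int.castRingHom ℂ)).mahlerMeasure := by
  obtain ⟨R, rfl⟩ := hdvd
  have hR : R ≠ 0 := right_ne_zero_of_mul hA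
  rw [Polynomial.map_mul, mahlerMeasure_mul]
  calc (Q.map (Int.castRingHom ℂ)).mahlerMeasure = (Q.map (Int.castRingHom ℂ)).mahlerMeasure * 1 :=
        (mul_one _).symm
    _ ≤ _ := mul_le_mul_of_nonneg_left (one_le_mahlerMeasure_map_of_ne_zero' hR) (mahlerMeasure_nonneg _)

/-- `log(q^D c) ≤ (D + c)·q` for `q ≥ 1`, `c ≥ 1`. -/
theorem log_pow_mul_le {q D : ℕ} {cG : ℝ} (hq : 1 ≤ q) (hcG : 1 ≤ cG) :
    Real.log ((q : ℝ) ^ D * cG) ≤ (D + cG) * q := by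
  have hq1 : (1 : ℝ) ≤ q := by exact_mod_cast hq
  have hD0 : (0 : ℝ) ≤ D := Nat.cast_nonneg D
  rw [Real.log_mul (by positivity) (by positivity), Real.log_pow]
  have h1 : Real.log (q : ℝ) ≤ q := (Real.log_le_sub_one_of_pos (by positivity)).trans (by linarith)
  have h2 : Real.log cG ≤ cG := (Real.log_le_sub_one_of_pos (by positivity)).trans (by linarith)
  have h3 : cG ≤ cG * q := le_mul_of_one_le_right (by linarith) hq1
  nlinarith

/-- `(q^D c)^𝔐 ≤ exp(wd·q^K·(D + c)·q)` when `𝔐 ≤ wd·q^K`. -/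
theorem pow_collapse_le_exp {q D K Mn : ℕ} {cG wd : ℝ} (hq : 1 ≤ q) (hcG : 1 ≤ cG)
    (hMn : (Mn : ℝ) ≤ wd * (q : ℝ) ^ K) :
    ((q : ℝ) ^ D * cG) ^ Mn ≤ Real.exp (wd * (q : ℝ) ^ K * ((D + cG) * q)) := by
  have hq1 : (1 : ℝ) ≤ q := by exact_mod_cast hq
  have hy1 : 1 ≤ (q : ℝ) ^ D * cG := one_le_mul_of_one_le_of_one_le (one_le_pow₀ hq1) hcG
  have hypos : 0 < (q : ℝ) ^ D * cG := by positivity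
  have hD0 : (0 : ℝ) ≤ D := Nat.cast_nonneg D
  rw [← Real.exp_log hypos, ← Real.exp_nat_mul]
  exact Real.exp_le_exp.mpr (mul_le_mul hMn (log_pow_mul_le hq hcG) (Real.log_nonneg hy1) (by
    have : (0 : ℝ) ≤ Mn := Nat.cast_nonneg Mn
    nlinarith [one_le_pow₀ (n := K) hq1]))

/-- **ORDER BUDGET (Tier 2), the inequality that fixes the class order.**  With the `endgame_gen` exponents
`a = 11K+1` (height side: `Φ ≤ c·q^a`) and `b = 2K` (degree side: `deg R₀ ≤ cN·q^b`), `K = Σ_l e_l`, the closing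
inequality `C·q^{a+b+1} ≤ q^m` holds with `m = 13K+3` as soon as `C ≤ q`; the class asks `LiouvilleOrder (13K+4)`,
the extra `+1` buying exactly the slack `q ≥ C` (and `q ≥ M + wd(D+cG)+1`) from `exp(−q^{13K+4}) ≤ exp(−q·q^{13K+3})`.
No numeral is hidden: `C` is the explicit constant assembled in `algebraicIndependent_radixPt`. -/
theorem order_budget_gen (K : ℕ) {q C : ℝ} (hq : 0 ≤ q) (hCq : C ≤ q) :
    C * q ^ (11 * K + 1 + 2 * K + 1) ≤ q ^ (13 * K + 3) := by
  have e1 : q ^ (13 * K + 3) = q * q ^ (11 * K + 1 + 2 * K + 1) := by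
    rw [show 13 * K + 3 = (11 * K + 1 + 2 * K + 1) + 1 by omega, pow_succ']
  rw [e1]
  exact mul_le_mul_of_nonneg_right hCq (by positivity)

end MixedEngine

end Summit.Schanuel.Schanuel.Theorems.RootDecomp1ERadixCell

end
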